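import Mathlib.Analysis.SpecialFunctions.Pow.Real
import Mathlib.Analysis.SpecialFunctions.Log.Basic
import Mathlib.Analysis.Complex.ExponentialBounds
import HarnessLib

/-!
# Cell pnp-psdrank, route `ChebyshevTracialDesign`: the scale `P = N₀^{1/8}` for the [BULK] numerics
# (crux `TracialDecayExp20`, stmt-PneNP-19878)

Brick 124a, part 1 (prover g24; MEMO-26 §7). Pure real arithmetic used by `ChebyshevTracialDesignBulkNumerics`: with
`P = N₀^{1/8}` one has `P⁸ = N₀`, `√N₀ = P⁴`, `log N₀ ≤ 8P²`, and `D⁴ ≤ 2N₀ ⇒ D ≤ 2P²` (`scale_facts`); the far-term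
count `D(4/3)^D ≤ e^D` (`mul_fourThirds_pow_le_exp`).
WHAT THIS FILE DOES NOT DO: anything combinatorial; anything on `TracialDecayExp20` itself, psd rank of P_PM(K_n),
or P vs NP. Stature: support/instrument (kernel lane, no defs, axioms standard). Supports stmt-PneNP-19878.
[cite: RollinRoss2010, §4.1 Thm 4.2 (the variance scale)] [cite: Agarwal2000DifferenceEquations, Remark 1.8.1]
-/

set_option linter.dupNamespace false -- `Summit.PneNP.PneNP.…`: summit = sub-problem (D-0017)

noncomputable section

namespace Summit.PneNP.PneNP.Theorems.ChebyshevTracialDesignBulkScale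

open Real

/-! ### §1 The scale `P = N₀^{1/8}` -/

/-- **The scale.** For `N₀ ≥ 1` and `P = N₀^{1/8}`: `1 ≤ P`, `P⁸ = N₀`, `√N₀ = P⁴`, `log N₀ ≤ 8P²`; and
`D⁴ ≤ 2N₀ ⇒ D ≤ 2P²`. [cite: RollinRoss2010, §4.1 Thm 4.2] -/
theorem scale_facts {N₀ : ℝ} (hN : 1 ≤ N₀) :
    1 ≤ N₀ ^ ((8 : ℕ) : ℝ)⁻¹ ∧ (N₀ ^ ((8 : ℕ) : ℝ)⁻¹) ^ 8 = N₀ ∧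
      Real.sqrt N₀ = (N₀ ^ ((8 : ℕ) : ℝ)⁻¹) ^ 4 ∧ Real.log N₀ ≤ 8 * (N₀ ^ ((8 : ℕ) : ℝ)⁻¹) ^ 2 ∧
      ∀ D : ℝ, 0 ≤ D → D ^ 4 ≤ 2 * N₀ → D ≤ 2 * (N₀ ^ ((8 : ℕ) : ℝ)⁻¹) ^ 2 := by
  set P := N₀ ^ ((8 : ℕ) : ℝ)⁻¹ with hP
  have hN0 : 0 ≤ N₀ := by linarith
  have hP8 : P ^ 8 = N₀ := Real.rpow_inv_natCast_pow hN0 (by norm_num)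
  have hP1 : 1 ≤ P := Real.one_le_rpow hN (by positivity)
  have hP0 : 0 ≤ P := by linarith
  have hsqrt : Real.sqrt N₀ = P ^ 4 := by
    rw [← hP8, show P ^ 8 = (P ^ 4) ^ 2 by ring, Real.sqrt_sq (by positivity)]
  have hlog : Real.log N₀ ≤ 8 * P ^ 2 := by
    rw [← hP8, Real.log_pow]
    have h1 : Real.log P ≤ P - 1 := Real.log_le_sub_one_of_pos (by linarith)
    have h2 : P ≤ P ^ 2 := by nlinarith
    push_cast; linarith
  refine ⟨hP1, hP8, hsqrt, hlog, fun D hD0 hD4 => ?_⟩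
  -- `D⁴ ≤ 2P⁸ ≤ (2P²)⁴`
  have h : D ^ 4 ≤ (2 * P ^ 2) ^ 4 := by
    calc D ^ 4 ≤ 2 * N₀ := hD4
      _ = 2 * P ^ 8 := by rw [hP8]
      _ ≤ (2 * P ^ 2) ^ 4 := by
          have : 0 ≤ P ^ 8 := by positivity
          nlinarith
  exact le_of_pow_le_pow_left₀ (by norm_num) (by positivity) h

/-- `D·(4/3)^D ≤ e^D` for natural `D` (`D ≤ 2^D` and `8/3 ≤ e`). [cite: Agarwal2000DifferenceEquations, Remark 1.8.1] -/
theorem mul_fourThirds_pow_le_exp (D : ℕ) : (D : ℝ) * (4 / 3 : ℝ) ^ D ≤ Real.exp D := by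
  have h1 : (D : ℝ) ≤ (2 : ℝ) ^ D := by exact_mod_cast (Nat.lt_two_pow_self).le
  have h2 : (2 : ℝ) ^ D * (4 / 3 : ℝ) ^ D = (8 / 3 : ℝ) ^ D := by rw [← mul_pow]; norm_num
  have h3 : (8 / 3 : ℝ) ≤ Real.exp 1 := by
    have := Real.exp_one_gt_d9; linarith
  calc (D : ℝ) * (4 / 3 : ℝ) ^ D ≤ (2 : ℝ) ^ D * (4 / 3 : ℝ) ^ D :=
        mul_le_mul_of_nonneg_right h1 (by positivity)
    _ = (8 / 3 : ℝ) ^ D := h2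
    _ ≤ (Real.exp 1) ^ D := pow_le_pow_left₀ (by norm_num) h3 D
    _ = Real.exp D := by rw [← Real.exp_one_pow]


end Summit.PneNP.PneNP.Theorems.ChebyshevTracialDesignBulkScale

end
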